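import Mathlib
import HarnessLib
import Literature.NumberTheory.EllipticCurves.KatoRankBound
import Literature.NumberTheory.EllipticCurves.KatoRankBoundProofs
import Literature.NumberTheory.EllipticCurves.Selmer
import Literature.NumberTheory.EllipticCurves.QuadraticTwist
import Literature.NumberTheory.EllipticCurves.AnalyticRank
import Literature.NumberTheory.EllipticCurves.Isogeny
import Literature.NumberTheory.EllipticCurves.LambdaInvariantCongruenceTransportAtTwo
import Literature.NumberTheory.EllipticCurves.Rank1Residual.Predicates
import Literature.NumberTheory.EllipticCurves.BSDSelmerParityDokchitserProofs
import Summits.BirchSwinnertonDyer.Rank1Residual.X5.TwoAdicTargetsGVTransport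
import Summits.BirchSwinnertonDyer.Rank2.Family81517MinimalOrdinary
import Summits.BirchSwinnertonDyer.Rank2.ParitySqueezeKernel
import Summits.BirchSwinnertonDyer.Rank2.Family81517Defs
import Summits.BirchSwinnertonDyer.BirchSwinnertonDyer.Theorems.TwoAdicConverseLambdaHalfCoeffCert
import Summits.BirchSwinnertonDyer.BirchSwinnertonDyer.Theorems.TwoAdicConverseLambdaHalfBridge
import Summits.BirchSwinnertonDyer.BirchSwinnertonDyer.Theorems.ByReductionTypeAtTwoOrdHalvesDefs

/-!

(FILE 1/2 — STATEMENTS ONLY: the `Prop` definitions of p2's FINAL door `p2/g14/LambdaTransportDoorAtTwo.lean`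
(sha256 e3af19d0f81e…), verbatim; the PROVED chain is FILE 2/2 `Rank2/LambdaTransportDoorAtTwoProofs.lean`,
verbatim — split only to honour the 400-line limit for files with proofs; filed by seat bsd-rank2-eng-2 GEN 4 per
director-bsd g7 ruling (D′)(2) 2026-08-27T05:34:27Z.)
# Rank2 kernel `LambdaTransportDoor` — door (F*) of cell bsd-rank2 seat p2 (route `TwoAdicLambdaTransport`, T-r3₂)

Statements (Prop defs, nothing asserted) and the PROVED deciding chain for the leaf
`Rank2.Family81517.SelmerCorankEqOrderEqThreeOnOddFamily` (p498463): on the 8-15-17 Tao–Ziegler family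
`E_{m,n} : y² + xy = x³ − (34(j+8n²)+13)x² + qr·x` (`AdmissibleF`: `m = 8j+3`, `q = m+64n²`, `r = m+289n²` prime,
`60 ∣ n`), root-number `−1` half (`OddSign`): `corank_{ℤ₂} Sel_{2^∞}(E/ℚ) = 3 = ord_{T=0} L₂(E,T)`.

* `PublishedInputsAtTwo` — fact pack: (a) Kato 17.4/18.4 at 2 on the family; (b) Tao–Ziegler infinitude of the odd
  sub-family; (c) `matsuno2008_thm42_lambda_transport_two ∧ matsuno2008_prop62_lambda_fullTwoTorsion_two ∧
  prop514_isTorsion_mu_eq_zero_two` by name; (d) Greenberg LNM 1716 Thm 1.9 (corank clause) at `ℚ₁ = ℚ(√2)` in the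
  form `s(E) + s(E^{(2)}) ≤ λ(X)` (= lit's `thm19_selmerCorank_layer_le_lambdaInvariant.…_two_le_of_isOrdinaryAt`,
  p497710/p498651); (e) `monsky_selmerCorank_two_mod_two_eq`; (f) Carayol (`IsNewformOf.level_eq_conductorNorm`).
* `RootNumberFacts` (support: `w(E) = w(E^{(2)}) = −1` on 𝓕₋ as odd analytic ranks), `ReferenceFacts` (support:
  Tate's algorithm at 3, 5, m, q, r and the auxiliary primes for `E`, `E′ = refOne`, `E″ = refFull`; isogeny `E″ → E′`).
* PROVED: `familyFacts_of_tree` (lit's `Rank2.familyFacts81517`, `Rank2.TwoIsogenyPlantedRank…`), `lambdaFourMuZero_of`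
  (λ(X) = 4, μ = 0, X torsion for EVERY member: Matsuno 6.2 at `E″`, isogeny invariance to `E′`, Matsuno 4.2 = GV-at-2
  transport `E′ ↦ E`; the auxiliary primes of `m − 36n²` cancel), `algebraicHalf` (`s(E) = 3`, `s(E^{(2)}) = 1` on 𝓕₋ by
  Thm 1.9 + Monsky + two planted points), `analyticLambdaLEFour_of_members` (the 2adic cell's per-curve λ-half
  `TwoAdicTwistConverse.LambdaHalfAtTwo` at a member + λ(X) = 4 ⇒ a unit coefficient of degree ≤ 4 in the 2-free part
  of the integral multiple), `membersLambdaHalf_of_ordLambdaHalfAtTwo` (item stmt-BirchSwinnertonDyer-19556 ⇒ crux),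
  `analyticOrderLEThree_of_line` (+ `ZeroAtMinusTwo` + `Rank2.paritySqueezeKernel` ⇒ ord ≤ 3), `leaf_of`, and the
  deciding theorems `closes : PublishedInputsAtTwo → RootNumberFacts → ReferenceFacts → MembersLambdaHalfAtTwo →
  ZeroAtMinusTwo → SelmerCorankEqOrderEqThreeOnOddFamily`, `closes_of_ordLambdaHalfAtTwo`, `closes_of_certificate`.
* CRUXES (open, research): `MembersLambdaHalfAtTwo` (λ_an ≤ λ_alg at 2 on the family = the 2adic cell's S3 object
  restricted; not in print at p = 2), `ZeroAtMinusTwo` (MTT interpolation at χ₈: `T + 2 ∣` every integral multiple of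
  `L₂` on 𝓕₋; prover chain in the tree: `isPAdicLFunctionOf_padicLFunction_holds`, `ratTwistedSymbolSum_mul_plusPeriod_holds`,
  `X_sub_C_dvd_of_evalAt_eq_zero`).
B1 honesty (director-bsd 2026-08-27T04:43Z (4)): the leaf is the ORDER part of 2-adic BSD at rank 3 on a density-zero
family — no Mordell–Weil rank 3, no analytic rank, nothing at odd p, nothing on 𝓕₊; S0's number does not move.
Source: cell bsd-rank2 HOME `p2/PADIC-R2-G14.md` §2–§4, `p2/g14/SketchG14.lean` (same content, sketch namespace).
-/

set_option linter.dupNamespace false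

noncomputable section

open PowerSeries WeierstrassCurve Literature.NumberTheory.EllipticCurves
  Literature.NumberTheory.EllipticCurves.ModularForms
  Literature.NumberTheory.EllipticCurves.Greenberg1999
  Literature.NumberTheory.EllipticCurves.Rank1Residual

namespace Summit.BirchSwinnertonDyer.Rank2.LambdaTransportDoor

open Summit.BirchSwinnertonDyer.Rank2.Family81517

/-- FACT PACK (published inputs at `p = 2`): (a) Kato Thm 18.4 at `2` on the family (`corank ≤ ord L₂`);
(b) Tao–Ziegler: the odd congruence sub-family is infinite; (c) Matsuno 2008 Thm 4.2 (one-point reading),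
Prop 6.2, Greenberg LNM 1716 Prop 5.14 at `2` (the tree's named facts, by name); (d) Greenberg Thm 1.9
(corank clause) at the layer `ℚ₁ = ℚ(√2)` + restriction `Sel(E/ℚ) ⊕ Sel(E^{(2)}/ℚ) → Sel(E/ℚ(√2))`
(kernel killed by 2): `s(E) + s(E^{(2)}) ≤ λ(X₂(E/ℚ_∞))`; (e) Monsky's 2-parity theorem; (f) Carayol 1986:
the level of the newform of `W` is its conductor (tree named fact `IsNewformOf.level_eq_conductorNorm`, every level).
(The cyclotomic datum exists by the tree theorems `exists_isCyclotomic_isTopGenerator_isCyclotomicVariable_holds`,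
`nonempty_selmerDualData_holds`.) -/
def PublishedInputsAtTwo : Prop :=
  (∀ j n : ℤ, AdmissibleF j n → ∀ (hmin : (curve j n).IsGloballyMinimal),
    ∀ ⦃N : ℕ⦄ [NeZero N] (f : CuspForm (CongruenceSubgroup.Gamma0 N) 2),
      IsNewformOf (curve j n) f →
        ((curve j n).selmerCorank 2 : ℕ∞) ≤
          (padicLFunction f (@unitRoot (curve j n) hmin 2 _ : ℚ_[2])).order) ∧
  Set.Infinite {jn : ℤ × ℤ | AdmissibleF jn.1 jn.2 ∧ OddSign jn.1 jn.2} ∧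
  (matsuno2008_thm42_lambda_transport_two ∧ matsuno2008_prop62_lambda_fullTwoTorsion_two ∧
    prop514_isTorsion_mu_eq_zero_two) ∧
  (∀ (W : WeierstrassCurve ℚ) [W.IsElliptic] [W.IsGloballyMinimal], IsOrdinaryAt W 2 →
    ∀ (κ : ZpExtension ℚ 2) (γ : Field.absoluteGaloisGroup ℚ), κ.IsCyclotomic → κ.IsTopGenerator γ →
      ∀ D : W.SelmerDualData κ γ, D.IsTorsion →
        W.selmerCorank 2 + (W.quadraticTwist 2).selmerCorank 2 ≤ D.lambda) ∧
  monsky_selmerCorank_two_mod_two_eq ∧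
  (∀ ⦃N : ℕ⦄ [NeZero N], IsNewformOf.level_eq_conductorNorm (N := N))

/-- DERIVED (family facts): every admissible member is elliptic, globally minimal, good ordinary at `2`, of
Mordell–Weil rank `≥ 2` (`P₁ = (q, 60nq)`, `P₂ = (16r, 960nr)`) — tree theorems of lit GEN 14
(`Rank2/Family81517MinimalOrdinary`, `Rank2/TwoIsogenyPlantedRankKernel`) — its twist by `2` is elliptic, and on
`𝓕₋` both `E` and `E^{(2)}` have odd analytic rank (`RootNumberFacts`). See `familyFacts_of_tree`. -/
def FamilyFacts : Prop :=
  ∀ j n : ℤ, AdmissibleF j n →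
    ∃ (_ : (curve j n).IsElliptic) (hmin : (curve j n).IsGloballyMinimal)
      (_ : (twistTwo j n).IsElliptic),
      @IsOrdinaryAt (curve j n) hmin 2 _ ∧ 2 ≤ (curve j n).mordellWeilRank ∧
      (OddSign j n → (curve j n).analyticRank % 2 = 1 ∧ (twistTwo j n).analyticRank % 2 = 1)

/-- SUPPORT (the only part of `FamilyFacts` not yet a tree theorem): on `𝓕₋` both `E` and `E^{(2)}` have
ODD analytic rank, i.e. root number `−1` (`w(E) = w₃w₅`, `w(E^{(2)}) = w(E)`; local root numbers at the
multiplicative primes `3, 5, m, r`, at the additive prime `q` (`e = 4`, `(−2/q) = +1`) and at `2` for the twist). -/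
def RootNumberFacts : Prop :=
  ∀ j n : ℤ, AdmissibleF j n → OddSign j n →
    (curve j n).analyticRank % 2 = 1 ∧ (twistTwo j n).analyticRank % 2 = 1

/-- SUPPORT (reference facts, elementary Tate-algorithm data of the three explicit models): `E`, `E′`,
`E″` good ordinary at `2`; `E″` has full rational 2-torsion and the Prop-5.14 point `(25m/4, −25m/8)`
(ramified, not odd); `E″ → E′` is a 2-isogeny; `E′`, `E` have exactly one rational point of order 2,
`(0,0)`, odd and not ramified (type B), with `Δ(E′)Δ(E)` a square; and the printed bookkeeping identity
`4 + Σ_{Σ₀}(E) = (LAW(N_{E″}) − 2) + Σ_{Σ₀}(E′)` (`N_E = 15 m q² r`, `N_{E′} = N_{E″} = 15 m q·rad(m − 36n²)`: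
the auxiliary primes of `m − 36n²` contribute `2·2^{n_ℓ}` on the left and `2^{n_ℓ} + 2^{n_ℓ}` on the right). -/
def ReferenceFacts : Prop :=
  ∀ j n : ℤ, AdmissibleF j n →
    ∃ (_ : (curve j n).IsElliptic) (_ : (curve j n).IsGloballyMinimal)
      (_ : (refOne j n).IsElliptic) (_ : (refOne j n).IsGloballyMinimal)
      (_ : (refFull j n).IsElliptic) (_ : (refFull j n).IsGloballyMinimal),
      GoodOrd (curve j n) 2 ∧ GoodOrd (refOne j n) 2 ∧ GoodOrd (refFull j n) 2 ∧
      ((refFull j n).toAffine.Equation ((25 * mOf j : ℚ) / 4) (-(25 * mOf j : ℚ) / 8) ∧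
        TwoTorsionRamifiedAtTwo ((25 * mOf j : ℚ) / 4) ∧
        ¬ TwoTorsionOdd (refFull j n) ((25 * mOf j : ℚ) / 4)) ∧
      ((0 : ℚ) ≠ (4 * (mOf j - 36 * n ^ 2) : ℚ) ∧ (0 : ℚ) ≠ (25 * mOf j : ℚ) / 4 ∧
        (4 * (mOf j - 36 * n ^ 2) : ℚ) ≠ (25 * mOf j : ℚ) / 4 ∧
        HasRationalTwoTorsionX (refFull j n) 0 ∧
        HasRationalTwoTorsionX (refFull j n) (4 * (mOf j - 36 * n ^ 2) : ℚ) ∧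
        HasRationalTwoTorsionX (refFull j n) ((25 * mOf j : ℚ) / 4)) ∧
      IsIsogenous (refFull j n) (refOne j n) ∧
      ((refOne j n).toAffine.Equation 0 0 ∧ TwoTorsionOdd (refOne j n) 0 ∧
        ¬ TwoTorsionRamifiedAtTwo 0) ∧
      (HasUniqueRationalTwoTorsionX (curve j n) 0 ∧ HasUniqueRationalTwoTorsionX (refOne j n) 0 ∧
        IsSquare ((refOne j n).Δ * (curve j n).Δ) ∧ SameGreenbergTypeAB (refOne j n) 0 (curve j n) 0) ∧
      4 + matsunoSigmaShiftAtTwo (curve j n)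
          (((refOne j n).conductorNorm ℤ * (curve j n).conductorNorm ℤ).primeFactors) =
        (matsunoLambdaLawAtTwo ((refFull j n).conductorNorm ℤ) - 2) +
          matsunoSigmaShiftAtTwo (refOne j n)
            (((refOne j n).conductorNorm ℤ * (curve j n).conductorNorm ℤ).primeFactors)

/-- DERIVED (provable now; kept as a named statement): `X₂(E/ℚ_∞)` is torsion with `μ = 0`, `λ = 4`
for every admissible member and every cyclotomic dual datum. -/
def LambdaFourMuZero : Prop :=
  ∀ j n : ℤ, AdmissibleF j n →
    ∀ (_ : (curve j n).IsElliptic) (_ : (curve j n).IsGloballyMinimal)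
      (κ : ZpExtension ℚ 2) (γ : Field.absoluteGaloisGroup ℚ), κ.IsCyclotomic → κ.IsTopGenerator γ →
      ∀ D : (curve j n).SelmerDualData κ γ, D.IsTorsion ∧ D.mu = 0 ∧ D.lambda = 4

/-- CRUX (rank 2, weakest load-bearing form): on `𝓕₋` the 2-adic `L`-function vanishes to order AT MOST 3
at `T = 0` (the missing half of `ord_{T=0} L₂ = corank = 3`; Kato gives `≥ 3`). -/
def AnalyticOrderLEThree : Prop :=
  ∀ j n : ℤ, AdmissibleF j n → OddSign j n → ∀ (hmin : (curve j n).IsGloballyMinimal)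
    ⦃N : ℕ⦄ [NeZero N] (f : CuspForm (CongruenceSubgroup.Gamma0 N) 2), IsNewformOf (curve j n) f →
      (padicLFunction f (@unitRoot (curve j n) hmin 2 _ : ℚ_[2])).order ≤ 3

/-! ### The K_F3 line for the crux (analytic Greenberg–Vatsal at 2 + the sign-forced zero at `T = −2`) -/

/-- LINE ITEM K_F3: `λ(L₂(E)) ≤ 4` after normalisation, for every admissible member. -/
def AnalyticLambdaLEFour : Prop :=
  ∀ j n : ℤ, AdmissibleF j n → ∀ (hmin : (curve j n).IsGloballyMinimal),
    ∀ ⦃N : ℕ⦄ [NeZero N] (f : CuspForm (CongruenceSubgroup.Gamma0 N) 2),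
      IsNewformOf (curve j n) f →
        ∃ (c : ℚ_[2]) (g : PowerSeries ℤ_[2]), c ≠ 0 ∧
          g.map (PadicInt.Coe.ringHom (p := 2)) =
            PowerSeries.C c * padicLFunction f (@unitRoot (curve j n) hmin 2 _ : ℚ_[2]) ∧
          ∃ i ≤ 4, IsUnit (PowerSeries.coeff i g)

/-- CRUX (rank 2 — RE-TYPED G14b, BY NAME the 2adic cell's object): **the `λ`-half of the `2`-adic main conjecture
AT EVERY MEMBER of the 8-15-17 family** — `LambdaHalfAtTwo (curve j n)` (the per-curve leaf of
`Theorems/TwoAdicConverseLambdaHalfDefs`, p425465: some nonzero integral rational multiple `L₀` of `L₂(f,α)` has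
`λ(L₀) ≤ λ(X(E/ℚ_∞))`, i.e. Greenberg–Vatsal's `λ_an ≤ λ_alg` at `2`). Its `∀`-closure over «non-CM, good ordinary
at 2» is the OPEN crux `OrdLambdaHalfAtTwo` = item stmt-BirchSwinnertonDyer-19556 of the tribunal-passed route
TwoAdicConverse (S3), so `OrdLambdaHalfAtTwo → MembersLambdaHalfAtTwo` is one line (`membersLambdaHalf_of_ordLambdaHalfAtTwo`);
and on the family (where `λ(X) = 4`, `μ = 0` are typed facts) it is EQUIVALENT to the certificate form
`AnalyticLambdaLEFour` (`analyticLambdaLEFour_of_members`). Not in print at `p = 2` (Skinner–Urban needs `p` odd). -/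
def MembersLambdaHalfAtTwo : Prop :=
  ∀ j n : ℤ, AdmissibleF j n →
    ∀ (hE : (curve j n).IsElliptic) (hmin : (curve j n).IsGloballyMinimal),
      @Summit.BirchSwinnertonDyer.BirchSwinnertonDyer.Theorems.TwoAdicTwistConverse.LambdaHalfAtTwo
        (curve j n) hE hmin

/-- SUPPORT (elementary): no member has CM — `j(E)` is non-integral (multiplicative reduction at `r`), while the
thirteen CM `j`-invariants are integers (tree named fact `j_mem_cmJInvariants_of_hasCM`, `cmJInvariants`). -/
def MembersNonCM : Prop :=
  ∀ j n : ℤ, AdmissibleF j n → ∀ (_ : (curve j n).IsElliptic), ¬ (curve j n).HasCM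

/-- CRUX 3 (K_F6, MTT interpolation at the order-2 character of `Γ`): for every admissible member whose quadratic
twist by `2` has POSITIVE analytic rank (`L(E^{(2)},1) = 0`; on `𝓕₋` this is the support `RootNumberFacts`), every
integral multiple `g` of `L₂(E,T)` is divisible by `T + 2` — i.e. `L₂(E, χ₈(γ)γ⁻¹… ) : g(−2) = 0`, because the
Mazur–Tate–Teitelbaum interpolation at the even conductor-8 character `χ₈` (field `ℚ(√2) = ℚ₁`, `χ₈(γ) = χ₈(5) = −1`,
so `T = −2`) gives `g(−2) = c · τ(χ₈)/α³ · L(E,χ₈,1)/Ω⁺_E = c′ · L(E^{(2)},1) = 0` (`(8, N_E) = 1`), and the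
factor theorem over `ℤ₂⟦T⟧` (tree `X_sub_C_dvd_of_evalAt_eq_zero`). The sign input is NOT part of this crux. -/
def ZeroAtMinusTwo : Prop :=
  ∀ j n : ℤ, AdmissibleF j n → 0 < (twistTwo j n).analyticRank → ∀ (hmin : (curve j n).IsGloballyMinimal),
    ∀ ⦃N : ℕ⦄ [NeZero N] (f : CuspForm (CongruenceSubgroup.Gamma0 N) 2),
      IsNewformOf (curve j n) f → ∀ (c : ℚ_[2]) (g : PowerSeries ℤ_[2]),
        g.map (PadicInt.Coe.ringHom (p := 2)) =
          PowerSeries.C c * padicLFunction f (@unitRoot (curve j n) hmin 2 _ : ℚ_[2]) →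
        (PowerSeries.X + PowerSeries.C (2 : ℤ_[2])) ∣ g

/-- Internal form of crux 3 on the odd half `𝓕₋` (the sign hypothesis folded in; `zeroAtMinusTwoOnOddHalf_of`). -/
def ZeroAtMinusTwoOnOddHalf : Prop :=
  ∀ j n : ℤ, AdmissibleF j n → OddSign j n → ∀ (hmin : (curve j n).IsGloballyMinimal),
    ∀ ⦃N : ℕ⦄ [NeZero N] (f : CuspForm (CongruenceSubgroup.Gamma0 N) 2),
      IsNewformOf (curve j n) f → ∀ (c : ℚ_[2]) (g : PowerSeries ℤ_[2]),
        g.map (PadicInt.Coe.ringHom (p := 2)) =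
          PowerSeries.C c * padicLFunction f (@unitRoot (curve j n) hmin 2 _ : ℚ_[2]) →
        (PowerSeries.X + PowerSeries.C (2 : ℤ_[2])) ∣ g

/-- LINE ITEM (pure algebra; LANDED as `Summit.BirchSwinnertonDyer.Rank2.paritySqueezeKernel`, p488343). -/
def ParitySqueezeKernel : Prop :=
  ∀ (L : PowerSeries ℚ_[2]) (c : ℚ_[2]) (g : PowerSeries ℤ_[2]), c ≠ 0 →
    g.map (PadicInt.Coe.ringHom (p := 2)) = PowerSeries.C c * L →
    (PowerSeries.X + PowerSeries.C (2 : ℤ_[2])) ∣ g →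
    (∃ i ≤ 4, IsUnit (PowerSeries.coeff i g)) → 3 ≤ L.order → L.order = 3

end Summit.BirchSwinnertonDyer.Rank2.LambdaTransportDoor

end
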